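import Summits.QuantumFields.BalabanUV.T4Continuum.Support.SmallFieldDomainsContour

/-!
# T⁴ programme, SUBSTRATE — `Support/SmallFieldDomainsContourGap`: the LEVEL GAP of the admissible-bond graph IN WALK FORM
# (no connectivity hypothesis), its `ℕ∞`-distance form, and print's BLOCK PROJECTION `x ↦ y_j(x)` ([Balaban1984PropagatorsII] p. 231)
# — repair of record of the located XREAD finding F-SUB-p2-X1 on `SmallFieldDomainsContour.levelGap_dist_admGraph` (map item P4-8b = LIBRARY W-13 = L-B5′;
# typed: typer ruling (κ1) l.16816, finder's GO l.16690)

Audit cell `pub-balaban`, SUBSTRATE cell seat p4 (gen 3); same namespace as `Support/SmallFieldDomains{,Contour}` (`BigDomainSeq`, `ptIndex`,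
`corner`, `admGraph`, `levelGap_admGraph`, `mem_of_ptIndex_pos`); `B6Geometry.LevelGap` and `B8ConstraintBonds.IsLevel ∕ Lam` BY NAME (nothing restated).

THE FINDING (substrate-p2 g3, journal l.16503, kernel witness `substrate/p2/xread/WitnessAdmGraphNotConnected.lean`).  `levelGap_dist_admGraph`
(p223984) displays `(admGraph L k Ω).Connected`; on the vertex type `Pt d = ℤ^d` this FAILS as soon as some `Ω_j`, `j ≥ 1`, has an interior point off
the `L`-lattice (such a point carries no admissible bond: an isolated vertex) — i.e. in every case of interest.  Print is not affected: (2.46) defines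
`d(y, y′)` as an INFIMUM OVER CONTOURS, which is `+∞` on pairs joined by no admissible contour, and `+∞` only helps in (2.60)–(2.63); it is Mathlib's
junk value `SimpleGraph.dist = 0` on unreachable pairs that forces the `Connected` binder in `B6Geometry.levelGap_dist`.
WHAT IS PRINTED (documentation; nothing asserted).  [Balaban1984PropagatorsII] p. 231: *"We may extend this definition and define the distance for a
pair of arbitrary points x, x′ ∈ T_η putting d(x, x′) = d(y_j(x), y_{j′}(x′)) if x ∈ B^j(Λ_j), x′ ∈ B^{j′}(Λ_{j′})"*; Lemma 2.1 (2.60) p. 234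
*"e^{−αδ₀d(y,y′)} ≦ e^{−αδ₀RM max{|j−j′|−1,0}}"*.
WHAT THIS FILE PROVIDES (all `[folklore]`):
 * §1 GENERIC, for ANY simple graph `G` on ANY vertex type with ANY zone map (the generality of `B6Geometry` §1, so that the lemma can be re-homed there):
   the first-crossing cut `exists_zone_crossing` and **`levelGap_walk`**: `LevelGap G zone N → zone x < zone x′ → ∀ p : G.Walk x x′,
   N·(zone x′ − zone x − 1) + 1 ≤ p.length` — the walk-by-walk content of (2.47)–(2.48) + (2.57) ⇒ (2.60), with NO `Connected` and NO `Reachable`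
   hypothesis (strong induction on the length: cut at the predecessor of the first vertex of zone `> zone x + 1`; the level gap pays `N` on the prefix,
   the induction hypothesis pays the rest on the strictly shorter suffix); hence **`levelGap_edist`**: `N·(…) + 1 ≤ G.edist x x′` in `ℕ∞` UNCONDITIONALLY
   (`edist = ⊤` on unreachable pairs — print's `+∞`), and `levelGap_dist_of_reachable` for Mathlib's `ℕ`-valued `dist` on reachable pairs;
 * §2 ON THE SUBSTRATE'S OBJECTS: `levelGap_walk_admGraph`, `levelGap_edist_admGraph`, `levelGap_dist_admGraph_of_reachable` for a big-block domain sequence,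
   `1 ≤ L`, every `N ≤ R·M₁` (from `levelGap_admGraph` BY NAME) — these SUPERSEDE the use of `levelGap_dist_admGraph` (which stays: true, vacuous);
 * §3 PRINT'S PROJECTION: `repPt L k Ω x := corner (L^{ι x}) x`, the level-`ι(x)` lattice point of the `L^{ι x}`-block of `x` (p. 231's `y_j(x)`):
   `isLevel_repPt`, `ptIndex_repPt : ι(repPt x) = ι(x)`, `repPt_mem_Lam : x ∈ Ω₀ → repPt x ∈ Λ_{ι x}` (print's vertex set `𝔅 = ⋃_j Λ_j`, (2.45)),
   `repPt_eq_self` on lattice points of their own level, and (2.60)'s shape AT ARBITRARY POINTS through the projection, `levelGap_edist_admGraph_repPt`.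
NOT CLAIMED: connectivity of `admGraph` on the projected vertex set (an inner hole of a layer can be cut off; print needs none — `+∞` is harmless).
HONEST FRAMING (T4-DAG p. 1).  Graph combinatorics + `ℤ^d` block geometry; no configuration, no estimate of any NE row ([B6] (2.61) untouched); spine 0/9
unchanged; NOT infinite volume, NOT a mass gap, NOT Clay.  HONEST DEPENDENCY: continuum YM on T⁴ ⇐ BetaPertH ∧ nine spine estimates (0/9 proved); BetaPertH ⇐
(D1) ∧ (D4) ∧ CAP+tail; G-an2-4 gates asym, D1 and NE2/3/4.  No `sorry`.
-/

noncomputable section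

namespace Summit.QuantumFields.BalabanUV.T4Continuum.SmallFieldDomains

open Literature.MathematicalPhysics.QuantumFieldTheory.Balaban1983to89.B14DomainGeom
open Literature.MathematicalPhysics.QuantumFieldTheory.Balaban1983to89.B8ConstraintBonds (IsLevel Lam)
open Literature.MathematicalPhysics.QuantumFieldTheory.Balaban1983to89.B6Geometry (LevelGap)
open Literature.MathematicalPhysics.QuantumLattice (blockMap blockBase)

variable {d : ℕ}

/-! ## §1 The level gap in WALK FORM (generic zoned graph; no connectivity hypothesis) -/

section Walk
variable {V : Type*} {G : SimpleGraph V} {zone : V → ℕ} {N : ℕ}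

/-- THE FIRST-CROSSING CUT: a walk from a vertex of zone `≤ i` to a vertex of zone `> i` contains an edge `u — v` with `zone u ≤ i < zone v`, cutting
it into a prefix `x → u`, that edge, and a suffix `v → x′` (lengths add up). [folklore] -/
theorem exists_zone_crossing (zone : V → ℕ) (i : ℕ) {x x' : V} (p : G.Walk x x') :
    zone x ≤ i → i < zone x' →
      ∃ (u v : V) (p₁ : G.Walk x u) (_ : G.Adj u v) (p₂ : G.Walk v x'),
        zone u ≤ i ∧ i < zone v ∧ p₁.length + 1 + p₂.length = p.length := by
  induction p with
  | nil => intro hx hx'; exact absurd (lt_of_le_of_lt hx hx') (lt_irrefl _)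
  | @cons a b c hab q ih =>
    intro ha hc
    by_cases hb : i < zone b
    · exact ⟨a, b, SimpleGraph.Walk.nil, hab, q, ha, hb, by
        simp only [SimpleGraph.Walk.length_nil, SimpleGraph.Walk.length_cons]; omega⟩
    · obtain ⟨u, v, p₁, h, p₂, hu, hv, hlen⟩ := ih (not_lt.mp hb) hc
      exact ⟨u, v, SimpleGraph.Walk.cons hab p₁, h, p₂, hu, hv, by
        simp only [SimpleGraph.Walk.length_cons]; omega⟩

/-- The walk form, with an explicit length bound for the induction. [folklore] -/
theorem levelGap_walk_aux (hgap : LevelGap G zone N) (n : ℕ) :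
    ∀ {x x' : V} (p : G.Walk x x'), p.length ≤ n → zone x < zone x' → N * (zone x' - zone x - 1) + 1 ≤ p.length := by
  induction n with
  | zero =>
    intro x x' p hlen hlt
    have hxx : x = x' := p.eq_of_length_eq_zero (Nat.le_zero.mp hlen)
    subst hxx
    exact absurd hlt (lt_irrefl _)
  | succ n ih =>
    intro x x' p hlen hlt
    -- a walk between points of different zones has at least one edge
    have hpos : 1 ≤ p.length := by
      rcases Nat.eq_zero_or_pos p.length with h0 | h0
      · have hxx : x = x' := p.eq_of_length_eq_zero h0
        subst hxx
        exact absurd hlt (lt_irrefl _)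
      · exact h0
    rcases Nat.lt_or_ge (zone x + 1) (zone x') with h2 | h2
    · -- `zone x' ≥ zone x + 2`: cut at the first crossing of the level `i = zone x + 1`
      obtain ⟨u, v, p₁, huv, p₂, hu, hv, hsum⟩ := exists_zone_crossing zone (zone x + 1) p (Nat.le_succ _) h2
      -- the level gap on the prefix `x → u → v`
      have hN : N + 1 ≤ (p₁.concat huv).length := hgap (Nat.lt_succ_self (zone x)) hv (p₁.concat huv)
      rw [SimpleGraph.Walk.length_concat] at hN
      rcases Nat.eq_zero_or_pos p₁.length with h0 | h0
      · -- the very first edge crosses: the level gap forces `N = 0`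
        have hN0 : N = 0 := by omega
        subst hN0
        rw [zero_mul, zero_add]
        exact hpos
      · -- the suffix `u → v → x'` is strictly shorter: induction
        have hlen' : (SimpleGraph.Walk.cons huv p₂).length ≤ n := by
          rw [SimpleGraph.Walk.length_cons]; omega
        have hlt' : zone u < zone x' := lt_of_le_of_lt hu h2
        have ih' := ih (SimpleGraph.Walk.cons huv p₂) hlen' hlt'
        rw [SimpleGraph.Walk.length_cons] at ih'
        have hmono : N * (zone x' - zone x - 1) ≤ N * (zone x' - zone u - 1) + N := by
          have h3 : zone x' - zone x - 1 ≤ zone x' - zone u - 1 + 1 := by omega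
          calc N * (zone x' - zone x - 1) ≤ N * (zone x' - zone u - 1 + 1) := Nat.mul_le_mul (le_refl N) h3
            _ = N * (zone x' - zone u - 1) + N := by ring
        omega
    · -- `zone x' = zone x + 1`: nothing to pay but the one edge
      have h3 : zone x' - zone x - 1 = 0 := by omega
      rw [h3, mul_zero, zero_add]
      exact hpos

/-- **THE LEVEL GAP IN WALK FORM** (the walk-by-walk content of (2.47)–(2.48) + (2.57) ⇒ (2.60), NO connectivity hypothesis): if every chain of bonds
from a point of zone `< i` to a point of zone `> i` has more than `N` bonds (each `i`), then EVERY chain from `x` to `x′`, `zone x < zone x′`, has at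
least `N·(zone x′ − zone x − 1) + 1` bonds.  Written in the generality of `Literature/…/B6Geometry` §1 (any simple graph, any zone map): the four
`Connected`-binder theorems there — `B6Geometry.levelGap_dist(_real)`, `triangle254_of_realizes`, `ineq260_of_levelGap`, `RealizedBy.exp_le_260` — can be
re-derived from this walk form on reachable pairs (pointer for that lineage ∕ the librarians; nothing of theirs is modified here). [folklore] -/
theorem levelGap_walk (hgap : LevelGap G zone N) {x x' : V} (hlt : zone x < zone x') (p : G.Walk x x') :
    N * (zone x' - zone x - 1) + 1 ≤ p.length :=
  levelGap_walk_aux hgap p.length p le_rfl hlt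

/-- The walk form read backwards (`zone x′ < zone x`). [folklore] -/
theorem levelGap_walk_symm (hgap : LevelGap G zone N) {x x' : V} (hlt : zone x' < zone x) (p : G.Walk x x') :
    N * (zone x - zone x' - 1) + 1 ≤ p.length := by
  rw [← SimpleGraph.Walk.length_reverse]
  exact levelGap_walk hgap hlt p.reverse

/-- **THE LEVEL GAP FOR THE `ℕ∞`-VALUED GRAPH DISTANCE, UNCONDITIONALLY**: `N·(zone x′ − zone x − 1) + 1 ≤ edist_G(x, x′)` — on unreachable pairs the
right-hand side is `⊤` (print's `d = +∞`: no admissible contour), on reachable pairs it is the length of a shortest chain. [folklore] -/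
theorem levelGap_edist (hgap : LevelGap G zone N) {x x' : V} (hlt : zone x < zone x') :
    ((N * (zone x' - zone x - 1) + 1 : ℕ) : ℕ∞) ≤ G.edist x x' := by
  unfold SimpleGraph.edist
  exact le_iInf fun p => by exact_mod_cast levelGap_walk hgap hlt p

/-- The level gap for Mathlib's `ℕ`-valued `SimpleGraph.dist` ON REACHABLE PAIRS (where `dist` is the length of a shortest chain; on unreachable pairs
Mathlib's `dist` is the junk value `0` and nothing can be said). [folklore] -/
theorem levelGap_dist_of_reachable (hgap : LevelGap G zone N) {x x' : V} (hr : G.Reachable x x') (hlt : zone x < zone x') :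
    N * (zone x' - zone x - 1) + 1 ≤ G.dist x x' := by
  obtain ⟨p, hp⟩ := hr.exists_walk_length_eq_dist
  rw [← hp]
  exact levelGap_walk hgap hlt p

end Walk

/-! ## §2 On the substrate's objects: the admissible-bond graph of a big-block domain sequence -/

section Junction
variable {L M₁ R k : ℕ} {Ω : ℕ → Set (Pt d)}

/-- **[B6] (2.60)'s SHAPE FOR ADMISSIBLE CHAINS ON `ℤ^d`, WALK FORM**: for a big-block domain sequence with `1 ≤ L` and every `N ≤ R·M₁`, every chain
of admissible bonds from `x` to `x′` with `ι x < ι x′` has at least `N·(ι x′ − ι x − 1) + 1` bonds — no connectivity or reachability hypothesis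
(`levelGap_admGraph` + `levelGap_walk`). [folklore] -/
theorem levelGap_walk_admGraph (hΩ : BigDomainSeq L M₁ R k Ω) (hL : 1 ≤ L) {N : ℕ} (hN : N ≤ R * M₁) {x x' : Pt d}
    (hlt : ptIndex k Ω x < ptIndex k Ω x') (p : (admGraph L k Ω).Walk x x') :
    N * (ptIndex k Ω x' - ptIndex k Ω x - 1) + 1 ≤ p.length :=
  levelGap_walk (levelGap_admGraph hΩ hL hN) hlt p

/-- The same for the `ℕ∞`-valued admissible-bond distance, UNCONDITIONALLY (`⊤` on pairs joined by no admissible chain). [folklore] -/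
theorem levelGap_edist_admGraph (hΩ : BigDomainSeq L M₁ R k Ω) (hL : 1 ≤ L) {N : ℕ} (hN : N ≤ R * M₁) {x x' : Pt d}
    (hlt : ptIndex k Ω x < ptIndex k Ω x') :
    ((N * (ptIndex k Ω x' - ptIndex k Ω x - 1) + 1 : ℕ) : ℕ∞) ≤ (admGraph L k Ω).edist x x' :=
  levelGap_edist (levelGap_admGraph hΩ hL hN) hlt

/-- The same for Mathlib's `ℕ`-valued `dist` on REACHABLE pairs — the non-vacuous replacement of `levelGap_dist_admGraph`'s `Connected` binder
(XREAD finding F-SUB-p2-X1). [folklore] -/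
theorem levelGap_dist_admGraph_of_reachable (hΩ : BigDomainSeq L M₁ R k Ω) (hL : 1 ≤ L) {N : ℕ} (hN : N ≤ R * M₁) {x x' : Pt d}
    (hr : (admGraph L k Ω).Reachable x x') (hlt : ptIndex k Ω x < ptIndex k Ω x') :
    N * (ptIndex k Ω x' - ptIndex k Ω x - 1) + 1 ≤ (admGraph L k Ω).dist x x' :=
  levelGap_dist_of_reachable (levelGap_admGraph hΩ hL hN) hr hlt

end Junction

/-! ## §3 Print's projection `x ↦ y_j(x)` onto the lattice point of the block (p. 231) -/

section Projection
variable {L M₁ R k : ℕ} {Ω : ℕ → Set (Pt d)}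

/-- The corner of `x`'s side-`s` cube has the same cube index as `x` (`s ≥ 1`). [folklore] -/
theorem cubeIdx_corner (s : ℕ) (hs : 0 < s) (x : Pt d) : cubeIdx s (corner s x) = cubeIdx s x := by
  funext i
  simp only [cubeIdx, corner]
  exact Int.mul_ediv_cancel_left _ (by exact_mod_cast hs.ne')

/-- The corner of the `L^j`-block of `x` is a level-`j` lattice point. [folklore] -/
theorem isLevel_corner (L j : ℕ) (x : Pt d) : IsLevel L j (corner (L ^ j) x) := fun i =>
  ⟨cubeIdx (L ^ j) x i, by simp only [corner, Nat.cast_pow]⟩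

/-- A lattice point of level `j`... more precisely: a point all of whose coordinates are divisible by `s` is its own side-`s` corner. [folklore] -/
theorem corner_eq_self_of_dvd (s : ℕ) {x : Pt d} (hx : ∀ i, (s : ℤ) ∣ x i) : corner s x = x := by
  funext i
  simp only [corner, cubeIdx]
  exact Int.mul_ediv_cancel' (hx i)

/-- **PRINT'S BLOCK REPRESENTATIVE `y_j(x)`** (p. 231): the level-`ι(x)` lattice point of the `L^{ι(x)}`-block containing `x` — the corner
`L^{ι x}·⌊x / L^{ι x}⌋` (`SmallFieldDomains.corner` BY NAME; `= blockBase ∘ blockMap` of the prelude, definitionally). [folklore] -/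
def repPt (L k : ℕ) (Ω : ℕ → Set (Pt d)) (x : Pt d) : Pt d := corner (L ^ ptIndex k Ω x) x

/-- `repPt x` is a level-`ι(x)` lattice point. [folklore] -/
theorem isLevel_repPt (L k : ℕ) (Ω : ℕ → Set (Pt d)) (x : Pt d) : IsLevel L (ptIndex k Ω x) (repPt L k Ω x) :=
  isLevel_corner L _ x

/-- `repPt x` lies in the `L^{ι x}`-block of `x`. [folklore] -/
theorem cubeIdx_repPt (hL : 0 < L) (k : ℕ) (Ω : ℕ → Set (Pt d)) (x : Pt d) :
    cubeIdx (L ^ ptIndex k Ω x) (repPt L k Ω x) = cubeIdx (L ^ ptIndex k Ω x) x :=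
  cubeIdx_corner _ (pow_pos hL _) x

/-- For a big-block domain sequence the corner of the `L^{ι x}`-block of `x` lies in exactly the same domains as `x` (every `Ω_i`, `i ≥ ι x`, is a union
of `L^{ι x}`-blocks; for `i < ι x` both points lie in `Ω_{ι x} ⊆ Ω_i`). [folklore] -/
theorem repPt_mem_iff (hΩ : BigDomainSeq L M₁ R k Ω) (hL : 0 < L) (x : Pt d) (i : ℕ) : repPt L k Ω x ∈ Ω i ↔ x ∈ Ω i := by
  have hidx := cubeIdx_repPt hL k Ω x
  rcases le_or_gt (ptIndex k Ω x) i with hji | hij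
  · exact hΩ.blocks_le hji _ _ hidx
  · have hxj : x ∈ Ω (ptIndex k Ω x) := mem_of_ptIndex_pos hΩ (lt_of_le_of_lt (Nat.zero_le i) hij) le_rfl
    have hyj : repPt L k Ω x ∈ Ω (ptIndex k Ω x) := (hΩ.blocks_le le_rfl _ _ hidx).mpr hxj
    exact ⟨fun _ => hΩ.anti_le hij.le hxj, fun _ => hΩ.anti_le hij.le hyj⟩

/-- **`ι(y_j(x)) = ι(x) = j`**: the block representative has the index of `x`. [folklore] -/
theorem ptIndex_repPt (hΩ : BigDomainSeq L M₁ R k Ω) (hL : 0 < L) (x : Pt d) : ptIndex k Ω (repPt L k Ω x) = ptIndex k Ω x := by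
  classical
  unfold ptIndex
  congr 1
  funext i
  exact propext (repPt_mem_iff hΩ hL x i)

/-- **`y_j(x) ∈ Λ_j`** (print's vertex set `𝔅 = ⋃_j Λ_j`, (2.45), in the tree's letters `B8ConstraintBonds.Lam`): for `x ∈ Ω₀` the block representative lies
in `Λ_{ι x} = Ω_{ι x}^{(ι x)} ∖ Ω_{ι x + 1}^{(ι x)}` (`mem_layer_iff_blockBase_mem_Lam` BY NAME). [folklore] -/
theorem repPt_mem_Lam (hΩ : BigDomainSeq L M₁ R k Ω) (hL : 0 < L) {x : Pt d} (hx : x ∈ Ω 0) :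
    repPt L k Ω x ∈ Lam L Ω (ptIndex k Ω x) :=
  (mem_layer_iff_blockBase_mem_Lam hΩ hL _ x).mp (mem_layer_ptIndex hΩ hx)

/-- A lattice point of its own level is its own representative (`y_j(y) = y` for `y ∈ Λ_j`). [folklore] -/
theorem repPt_eq_self (L k : ℕ) (Ω : ℕ → Set (Pt d)) {x : Pt d} (hx : IsLevel L (ptIndex k Ω x) x) : repPt L k Ω x = x :=
  corner_eq_self_of_dvd _ fun i => by have := hx i; push_cast; exact this

/-- The projection is idempotent. [folklore] -/
theorem repPt_repPt (hΩ : BigDomainSeq L M₁ R k Ω) (hL : 0 < L) (x : Pt d) : repPt L k Ω (repPt L k Ω x) = repPt L k Ω x :=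
  repPt_eq_self L k Ω (by rw [ptIndex_repPt hΩ hL]; exact isLevel_repPt L k Ω x)

/-- **(2.60)'s SHAPE AT ARBITRARY POINTS THROUGH PRINT'S PROJECTION** (p. 231 *"d(x, x′) = d(y_j(x), y_{j′}(x′))"*): for a big-block domain sequence,
`1 ≤ L`, `N ≤ R·M₁` and `ι x < ι x′`, every admissible chain from `y_{ι x}(x)` to `y_{ι x′}(x′)` has at least `N·(ι x′ − ι x − 1) + 1` bonds — stated for
the `ℕ∞`-valued distance, unconditionally.  READER'S CAUTION (not a finiteness claim): the right-hand side CAN be `⊤` for a legitimate `BigDomainSeq` — no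
admissible chain joins the two representatives (e.g. in `d = 1`, where a domain `Ω_{j+1}` cuts the layer `j` in two and its upper face carries no lattice point
of level `j+1` under the half-open block convention); connectivity of `admGraph` on the projected vertex set is NOT claimed (print needs none). [folklore] -/
theorem levelGap_edist_admGraph_repPt (hΩ : BigDomainSeq L M₁ R k Ω) (hL : 1 ≤ L) {N : ℕ} (hN : N ≤ R * M₁) {x x' : Pt d}
    (hlt : ptIndex k Ω x < ptIndex k Ω x') :
    ((N * (ptIndex k Ω x' - ptIndex k Ω x - 1) + 1 : ℕ) : ℕ∞) ≤ (admGraph L k Ω).edist (repPt L k Ω x) (repPt L k Ω x') := by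
  have hL0 : 0 < L := lt_of_lt_of_le Nat.zero_lt_one hL
  have h := levelGap_edist_admGraph hΩ hL hN (x := repPt L k Ω x) (x' := repPt L k Ω x')
    (by rw [ptIndex_repPt hΩ hL0, ptIndex_repPt hΩ hL0]; exact hlt)
  rwa [ptIndex_repPt hΩ hL0, ptIndex_repPt hΩ hL0] at h

/-- The walk form at arbitrary points through the projection. [folklore] -/
theorem levelGap_walk_admGraph_repPt (hΩ : BigDomainSeq L M₁ R k Ω) (hL : 1 ≤ L) {N : ℕ} (hN : N ≤ R * M₁) {x x' : Pt d}
    (hlt : ptIndex k Ω x < ptIndex k Ω x') (p : (admGraph L k Ω).Walk (repPt L k Ω x) (repPt L k Ω x')) :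
    N * (ptIndex k Ω x' - ptIndex k Ω x - 1) + 1 ≤ p.length := by
  have hL0 : 0 < L := lt_of_lt_of_le Nat.zero_lt_one hL
  have h := levelGap_walk_admGraph hΩ hL hN (x := repPt L k Ω x) (x' := repPt L k Ω x')
    (by rw [ptIndex_repPt hΩ hL0, ptIndex_repPt hΩ hL0]; exact hlt) p
  rwa [ptIndex_repPt hΩ hL0, ptIndex_repPt hΩ hL0] at h

end Projection

end Summit.QuantumFields.BalabanUV.T4Continuum.SmallFieldDomains

end
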